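import Literature.MeasureTheory.Group.InvariantQuotientConjugacySumPartial
import Mathlib.MeasureTheory.Integral.Bochner.Basic
import HarnessLib

/-!
# Splitting the sum over conjugates along a partition of `S`, and the central classes
(Gelbart, *Automorphic forms on adele groups* (1975), (9.39) and Prop. 9.10: `K(x, x)` is the sum
of its central ("singular"), elliptic and parabolic parts, and the central part contributes
`meas(X) Σ_{μ ∈ Z_ℚ} f(μ)`)

Topic `MeasureTheory/Group`; theorems only (no definition, no named fact, no instance). Two
elementary supplements to `InvariantQuotientConjugacySum(Partial)`, used to organise the geometric
side of the trace formula on a non-compact quotient class-type by class-type: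

* `conj_mem_diff` — if `S ⊆ T` are both stable under conjugation by `L`, so is `T ∖ S`;
  `conjTsum_eq_conjTsum_add_conjTsum_diff_ennreal`, `conjTsum_eq_conjTsum_add_conjTsum_diff` —
  **`Σ'_{t ∈ T} F(x t x⁻¹) = Σ'_{s ∈ S} F(x s x⁻¹) + Σ'_{t ∈ T ∖ S} F(x t x⁻¹)`**, unconditionally for
  `F ≥ 0` in `[0, ∞]`, and for Banach-valued `F` whenever the sum over `T` converges absolutely at
  the point (Gelbart (9.39): the decomposition of the kernel on the diagonal).
* `conjTsum_mk_of_subset_center`, `lintegral_conjTsum_of_subset_center`,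
  `integral_conjTsum_of_subset_center` — **for `S` central, `x ↦ Σ'_{s ∈ S} F(x s x⁻¹)` is the
  constant `Σ'_{s ∈ S} F(s)`**, so `∫_{G ⧸ L} Σ'_{s ∈ S} F(x s x⁻¹) dμ = μ(G ⧸ L) · Σ'_{s ∈ S} F(s)` —
  Gelbart's contribution `meas(Z_∞⁺ G_ℚ \ G_𝔸) Σ_{μ ∈ Z_ℚ} f(μ)` of the central classes (Prop. 9.10,
  Thm. 9.22 (i)), valid on any quotient of finite volume.

## References

* S. Gelbart, *Automorphic forms on adele groups*, Ann. of Math. Studies 83 (1975), (9.39),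
  Prop. 9.10, Thm. 9.22 (i) [Gelbart1975].
-/

noncomputable section

open _root_.MeasureTheory _root_.MeasureTheory.Measure _root_.Topology Set Filter
open scoped ENNReal NNReal Pointwise

/- Work with Borel structures on the coset spaces, as in `InvariantQuotientConjugacySum`. -/
attribute [-instance] Quotient.instMeasurableSpace QuotientGroup.measurableSpace

namespace Literature.MeasureTheory.Group

variable {G : Type*} [Group G] (L : Subgroup G)

/-! ### Splitting along `S ⊆ T` -/

section Split

variable {S T : Set G} (hST : S ⊆ T)
  (hT : ∀ ℓ ∈ L, ∀ t ∈ T, ℓ * t * ℓ⁻¹ ∈ T) (hS : ∀ ℓ ∈ L, ∀ s ∈ S, ℓ * s * ℓ⁻¹ ∈ S)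

include hT hS in
/-- If `S ⊆ T` are stable under conjugation by the subgroup `L`, so is `T ∖ S` (conjugation by
`ℓ⁻¹ ∈ L` maps `S` into `S`). [folklore] -/
theorem conj_mem_diff : ∀ ℓ ∈ L, ∀ t ∈ T \ S, ℓ * t * ℓ⁻¹ ∈ T \ S := by
  intro ℓ hℓ t ht
  refine ⟨hT ℓ hℓ t ht.1, fun hs => ht.2 ?_⟩
  have h := hS ℓ⁻¹ (L.inv_mem hℓ) _ hs
  rwa [show ℓ⁻¹ * (ℓ * t * ℓ⁻¹) * ℓ⁻¹⁻¹ = t by group] at h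

omit [Group G] in
/-- The index set `S ∪ (T ∖ S)` is `T`. [folklore] -/
theorem tsum_subtype_union_diff_eq {α : Type*} [AddCommMonoid α] [TopologicalSpace α]
    (hST : S ⊆ T) (f : G → α) :
    ∑' t : ↥(S ∪ (T \ S)), f t = ∑' t : T, f t :=
  tsum_congr_set_coe f (Set.union_sdiff_cancel hST)

include hST in
/-- **Splitting the sum over conjugates, `[0, ∞]`-valued**: for `S ⊆ T` both `L`-stable and
`F ≥ 0`, `Σ'_{t ∈ T} F(x t x⁻¹) = Σ'_{s ∈ S} F(x s x⁻¹) + Σ'_{t ∈ T ∖ S} F(x t x⁻¹)`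
(Gelbart (1975), (9.39)). [cite: Gelbart1975, (9.39)] -/
theorem conjTsum_eq_conjTsum_add_conjTsum_diff_ennreal (F : G → ℝ≥0∞) (x : G ⧸ L) :
    conjTsum L T hT F x = conjTsum L S hS F x + conjTsum L (T \ S) (conj_mem_diff L hT hS) F x := by
  induction x using QuotientGroup.induction_on with
  | H g =>
    simp only [conjTsum_mk]
    rw [← tsum_subtype_union_diff_eq hST (fun t => F (g * t * g⁻¹))]
    exact ENNReal.summable.tsum_union_disjoint (f := fun t => F (g * t * g⁻¹))
      Set.disjoint_sdiff_right ENNReal.summable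

include hST in
/-- **Splitting the sum over conjugates, Banach-valued**: for `S ⊆ T` both `L`-stable and `F`
with `Σ_{t ∈ T} F(g t g⁻¹)` absolutely convergent,
`Σ'_{t ∈ T} F(g t g⁻¹) = Σ'_{s ∈ S} F(g s g⁻¹) + Σ'_{t ∈ T ∖ S} F(g t g⁻¹)` (Gelbart (1975), (9.39):
`K = ` central `+` elliptic `+` parabolic parts). [cite: Gelbart1975, (9.39)] -/
theorem conjTsum_eq_conjTsum_add_conjTsum_diff {E : Type*} [NormedAddCommGroup E]
    [CompleteSpace E] (F : G → E) (g : G) (hsum : Summable fun t : T => F (g * t * g⁻¹)) :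
    conjTsum L T hT F (QuotientGroup.mk g) =
      conjTsum L S hS F (QuotientGroup.mk g) +
        conjTsum L (T \ S) (conj_mem_diff L hT hS) F (QuotientGroup.mk g) := by
  simp only [conjTsum_mk]
  -- summability on the two pieces, by restriction along the injections into `T`
  have h1 : Summable fun s : S => F (g * s * g⁻¹) := by
    have := hsum.comp_injective (i := fun s : S => (⟨s, hST s.2⟩ : T))
      (fun a b h => Subtype.ext (congrArg (fun t : T => (t : G)) h))
    exact this
  have h2 : Summable fun t : ↥(T \ S) => F (g * t * g⁻¹) := by
    have := hsum.comp_injective (i := fun t : ↥(T \ S) => (⟨t, t.2.1⟩ : T))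
      (fun a b h => Subtype.ext (congrArg (fun t : T => (t : G)) h))
    exact this
  rw [← tsum_subtype_union_diff_eq hST (fun t => F (g * t * g⁻¹))]
  exact h1.tsum_union_disjoint (f := fun t => F (g * t * g⁻¹)) Set.disjoint_sdiff_right h2

end Split

/-! ### Central classes -/

section Central

variable {S : Set G} (hS : ∀ ℓ ∈ L, ∀ s ∈ S, ℓ * s * ℓ⁻¹ ∈ S) (hZ : S ⊆ Subgroup.center G)

include hZ in
/-- **For central `S` the sum over conjugates is constant**: `Σ'_{s ∈ S} F(g s g⁻¹) = Σ'_{s ∈ S} F(s)`.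
[cite: Gelbart1975, Prop. 9.10] -/
theorem conjTsum_mk_of_subset_center {α : Type*} [AddCommMonoid α] [TopologicalSpace α]
    (F : G → α) (g : G) :
    conjTsum L S hS F (QuotientGroup.mk g) = ∑' s : S, F s := by
  rw [conjTsum_mk]
  refine tsum_congr fun s => ?_
  have h : g * (s : G) = (s : G) * g := (Subgroup.mem_center_iff.1 (hZ s.2) g)
  rw [h, mul_inv_cancel_right]

include hZ in
/-- The sum over central conjugates as a function on `G ⧸ L` is the constant `Σ'_{s ∈ S} F(s)`.
[folklore] -/
theorem conjTsum_of_subset_center {α : Type*} [AddCommMonoid α] [TopologicalSpace α]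
    (F : G → α) : conjTsum L S hS F = fun _ => ∑' s : S, F s := by
  funext x
  induction x using QuotientGroup.induction_on with
  | H g => exact conjTsum_mk_of_subset_center L hS hZ F g

include hZ in
/-- **The central classes contribute `μ(G ⧸ L) · Σ'_{s ∈ S} F(s)`**, `[0, ∞]`-valued (Gelbart
(1975), Prop. 9.10 / Thm. 9.22 (i): `meas(Z_∞⁺ G_ℚ \ G_𝔸) Σ_{μ ∈ Z_ℚ} f(μ)`; here for any
measure `μ` on the coset space). [cite: Gelbart1975, Prop. 9.10] -/
theorem lintegral_conjTsum_of_subset_center [MeasurableSpace (G ⧸ L)] (μ : Measure (G ⧸ L))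
    (F : G → ℝ≥0∞) :
    ∫⁻ x, conjTsum L S hS F x ∂μ = (∑' s : S, F s) * μ Set.univ := by
  rw [conjTsum_of_subset_center L hS hZ F, lintegral_const]

include hZ in
/-- **The central classes contribute `μ(G ⧸ L) · Σ'_{s ∈ S} F(s)`**, Banach-valued: for a finite
measure `μ` on `G ⧸ L`, `∫ Σ'_{s ∈ S} F(x̃ s x̃⁻¹) dμ = μ(G ⧸ L) • Σ'_{s ∈ S} F(s)` (Gelbart (1975),
Prop. 9.10: the "singular" term, "there is little to say except that `X` has finite measure").
[cite: Gelbart1975, Prop. 9.10] -/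
theorem integral_conjTsum_of_subset_center {E : Type*} [NormedAddCommGroup E] [NormedSpace ℝ E]
    [CompleteSpace E] [MeasurableSpace (G ⧸ L)] (μ : Measure (G ⧸ L)) (F : G → E) :
    ∫ x, conjTsum L S hS F x ∂μ = (μ Set.univ).toReal • ∑' s : S, F s := by
  rw [conjTsum_of_subset_center L hS hZ F, integral_const, Measure.real]

include hZ in
/-- The central sum is integrable on a quotient of finite measure (it is constant). [folklore] -/
theorem integrable_conjTsum_of_subset_center {E : Type*} [NormedAddCommGroup E]
    [MeasurableSpace (G ⧸ L)] (μ : Measure (G ⧸ L)) [IsFiniteMeasure μ] (F : G → E) :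
    Integrable (conjTsum L S hS F) μ := by
  rw [conjTsum_of_subset_center L hS hZ F]
  exact integrable_const _

end Central

end Literature.MeasureTheory.Group
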